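import Mathlib
import HarnessLib
import Literature.Combinatorics.Additive.StepBeyondKempermanTypes
import Literature.Combinatorics.Additive.KempermanDecompositionLift

/-!
# Grynkiewicz 2009, §6 Claim 4: lifting the conclusion of Theorem 4.1 through Lemma 5.3

[cite: Grynkiewicz2009, §6 Claim 4 (proof of Thm 4.1)] [tag: critical-pair] [tag: inverse-theorem]

Topic `Literature/Combinatorics/Additive`.  Cell `mm-stpp` (D-0046), seat `mm-stpp-lit` (gen 23); the
port of D. J. Grynkiewicz, *A step beyond Kemperman's structure theorem*, Mathematika **55** (2009)
67–114 continued.  §6, **Claim 4** (print p. 24): «It suffices to prove Theorem 4.1 in the case both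
`A` and `B` are non-quasi-periodic sets with `⟨A⟩ = ⟨B⟩ = G`.  In view of Claim 1 and previous
assumptions, the hypotheses of Lemma 5.3 hold for `A` and `B`.  However, it is readily checked that if
`A = A₁ ∪ A₀` and `B = B₁ ∪ B₀` are quasi-periodic decompositions satisfying the conclusion of Lemma 5.3,
and if Theorem 4.1 holds for the pair `(A₀, B₀)`, then Theorem 4.1 holds for the pair `(A, B)`.»  This
file is the «readily checked» part: both alternatives of Theorem 4.1 for the bottom pair `(A', B')` of
Lemma 5.3's data (`exists_isQuasiPeriodicDecomp_of_isQuasiPeriodicDecomp`,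
`QuasiPeriodicDecompositions.lean`) LIFT to `(A, B)` — (17) by `seventeen_of_coarse`, the decomposition
(with a quasi-period `K ≤ H`) by `IsGrynkiewiczDecomp.lift`, exactly as Kemperman's inclusion (3) was
lifted in `KempermanDecompositionLift.lean` (`IsKempermanDecompI.lift`, whose bookkeeping lemmas
`sub_notMem_of_coarse`, `add_eq_of_coarse`, `cosetCount_eq_mul_of_isPeriodicWith` are reused).
Not here: the choice of REDUCED decompositions (second paragraph of Claim 4) and the passage to the
subgroup `H` (the bottom pair lives in `H`-cosets; Theorem 4.1 is applied to it inside `H`).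

MAIN RESULTS (0 definitions, 0 named facts; everything PROVED).
* `Grynkiewicz2009.seventeen_of_coarse` — (17) for `(A', B')` with holes in the cosets of `A'`, `B'`
  gives (17) for `(A, B)`.
* `IsGrynkiewiczDecomp.lift`, `IsGrynkiewiczDecomp.of_coarse` — the decomposition of Theorem 4.1
  for `(A', B')` with quasi-period `K ≤ H` (resp. `(A', B')` itself of type (V)–(VIII)) gives one for
  `(A, B)`.

## References
* D. J. Grynkiewicz, *A step beyond Kemperman's structure theorem*, Mathematika 55 (2009) 67–114,
  doi:10.1112/S0025579300000966, §6 Claim 4 (p. 24) [cite: Grynkiewicz2009, Thm 4.1 (proof, Claim 4)]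
  — held `paper:doi-10-1112-s0025579300000966`.
-/

namespace Literature.Combinatorics.Additive

open Finset
open scoped Pointwise

universe u

variable {G : Type u} [AddCommGroup G] [DecidableEq G]

section Lift

variable {K H : AddSubgroup G} {Hf A B A₁ A' B₁ B' A₁' A₀ B₁' B₀ : Finset G}

/-- **Lifting the decomposition of Theorem 4.1** through coarse data relative to `H` (the conclusion
of Lemma 5.3: quasi-periodic decompositions `A = A₁ ∪ A'`, `B = B₁ ∪ B'` with quasi-period `H`,
(i) and (ii)): if the bottom pair `(A', B')` has a decomposition of Theorem 4.1 with quasi-period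
`K ≤ H`, then so does `(A, B)`, with periodic parts `A₁ ∪ A₁'`, `B₁ ∪ B₁'` and the same bottom pair.
`H` finite, given by a carrier finset `Hf`.  (The proof of `IsKempermanDecompI.lift` verbatim.)
[cite: Grynkiewicz2009, §6 Claim 4 («it is readily checked that … Theorem 4.1 holds for the pair
(A, B)»)] -/
theorem IsGrynkiewiczDecomp.lift (hKH : K ≤ H) (hHf : ∀ g, g ∈ Hf ↔ g ∈ H)
    (hdA : IsQuasiPeriodicDecomp H A A₁ A') (hdB : IsQuasiPeriodicDecomp H B B₁ B')
    (hi : ∀ a ∈ A, ∀ b ∈ B, ∀ a' ∈ A', ∀ b' ∈ B', (a + b) - (a' + b') ∈ H → a - a' ∈ H ∧ b - b' ∈ H)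
    (hii : cosetCount H (A + B) + 1 = cosetCount H A + cosetCount H B)
    (hK : IsGrynkiewiczDecomp K A' B' A₁' A₀ B₁' B₀) :
    IsGrynkiewiczDecomp K A B (A₁ ∪ A₁') A₀ (B₁ ∪ B₁') B₀ := by
  have hA₀ : A₀ ⊆ A' := hK.decomp_left.right_subset
  have hB₀ : B₀ ⊆ B' := hK.decomp_right.right_subset
  have hA'ne : A'.Nonempty := hK.left_nonempty.mono hA₀
  have hB'ne : B'.Nonempty := hK.right_nonempty.mono hB₀
  refine
    { decomp_left := ⟨hK.decomp_left.ne_bot,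
        disjoint_union_left.2 ⟨hdA.disjoint.mono_right hA₀, hK.decomp_left.disjoint⟩,
        by rw [union_assoc, hK.decomp_left.union_eq, hdA.union_eq],
        (hdA.periodic.anti hKH).union hK.decomp_left.periodic, hK.decomp_left.sub_mem⟩
      decomp_right := ⟨hK.decomp_right.ne_bot,
        disjoint_union_left.2 ⟨hdB.disjoint.mono_right hB₀, hK.decomp_right.disjoint⟩,
        by rw [union_assoc, hK.decomp_right.union_eq, hdB.union_eq],
        (hdB.periodic.anti hKH).union hK.decomp_right.periodic, hK.decomp_right.sub_mem⟩
      left_nonempty := hK.left_nonempty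
      right_nonempty := hK.right_nonempty
      quot_unique := ?_
      cosetCount_add := ?_
      bottom := hK.bottom }
  · intro a ha b hb a₀ ha₀ b₀ hb₀ hq
    obtain ⟨haH, hbH⟩ := hi a ha b hb a₀ (hA₀ ha₀) b₀ (hB₀ hb₀) (hKH hq)
    exact hK.quot_unique a (hdA.mem_right_of_sub_mem ha (hA₀ ha₀) haH) b
      (hdB.mem_right_of_sub_mem hb (hB₀ hb₀) hbH) a₀ ha₀ b₀ hb₀ hq
  · set P := A₁ + B ∪ (A' + B₁) with hPdef
    have hPper : IsPeriodicWith H P := (hdA.periodic.add_right B).union (hdB.periodic.add_left A')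
    have hsplit : A + B = P ∪ (A' + B') := add_eq_of_coarse hdA hdB
    have hdiffH : ∀ p ∈ P, ∀ c ∈ A' + B', p - c ∉ H := fun p hp c hc =>
      sub_notMem_of_coarse hdA hdB hi hp hc
    have hdiffK : ∀ p ∈ P, ∀ c ∈ A' + B', p - c ∉ K := fun p hp c hc h =>
      hdiffH p hp c hc (hKH h)
    have hone : cosetCount H (A' + B') = 1 := by
      refine cosetCount_eq_one_of_sub_mem (hA'ne.add hB'ne) fun x hx y hy => ?_
      obtain ⟨a, ha, b, hb, rfl⟩ := mem_add.1 hx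
      obtain ⟨a', ha', b', hb', rfl⟩ := mem_add.1 hy
      rw [add_sub_add_comm]
      exact H.add_mem (hdA.sub_mem a ha a' ha') (hdB.sub_mem b hb b' hb')
    have idx := cosetCount_eq_mul_of_isPeriodicWith hKH hHf
    have e1 : cosetCount K (A + B) = cosetCount K Hf * cosetCount H P + cosetCount K (A' + B') := by
      rw [hsplit, cosetCount_union hdiffK, idx P hPper]
    have e1H : cosetCount H (A + B) = cosetCount H P + 1 := by
      rw [hsplit, cosetCount_union hdiffH, hone]
    have hAK : ∀ x ∈ A₁, ∀ y ∈ A', x - y ∉ K := fun x hx y hy h => hdA.sub_notMem hx hy (hKH h)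
    have hBK : ∀ x ∈ B₁, ∀ y ∈ B', x - y ∉ K := fun x hx y hy h => hdB.sub_notMem hx hy (hKH h)
    have e2 : cosetCount K A = cosetCount K Hf * cosetCount H A₁ + cosetCount K A' := by
      conv_lhs => rw [← hdA.union_eq]
      rw [cosetCount_union hAK, idx A₁ hdA.periodic]
    have e3 : cosetCount K B = cosetCount K Hf * cosetCount H B₁ + cosetCount K B' := by
      conv_lhs => rw [← hdB.union_eq]
      rw [cosetCount_union hBK, idx B₁ hdB.periodic]
    have e2H := hdA.cosetCount_eq hA'ne
    have e3H := hdB.cosetCount_eq hB'ne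
    have hP : cosetCount H P = cosetCount H A₁ + cosetCount H B₁ := by
      rw [e1H, e2H, e3H] at hii; omega
    have hKc := hK.cosetCount_add
    rw [e1, e2, e3, hP, mul_add]
    generalize cosetCount K Hf * cosetCount H A₁ = u at *
    generalize cosetCount K Hf * cosetCount H B₁ = v at *
    omega

/-- The degenerate lift: if the bottom pair `(A', B')` of the coarse data is itself of type (V),
(VI), (VII) or (VIII), the coarse data IS a decomposition of Theorem 4.1 with quasi-period `H`.
[cite: Grynkiewicz2009, §6 Claim 4] -/
theorem IsGrynkiewiczDecomp.of_coarse (hdA : IsQuasiPeriodicDecomp H A A₁ A')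
    (hdB : IsQuasiPeriodicDecomp H B B₁ B') (hA' : A'.Nonempty) (hB' : B'.Nonempty)
    (hi : ∀ a ∈ A, ∀ b ∈ B, ∀ a' ∈ A', ∀ b' ∈ B', (a + b) - (a' + b') ∈ H → a - a' ∈ H ∧ b - b' ∈ H)
    (hii : cosetCount H (A + B) + 1 = cosetCount H A + cosetCount H B)
    (hbot : IsTypeV A' B' ∨ IsTypeVI A' B' ∨ IsTypeVII A' B' ∨ IsTypeVIII A' B') :
    IsGrynkiewiczDecomp H A B A₁ A' B₁ B' where
  decomp_left := hdA
  decomp_right := hdB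
  left_nonempty := hA'
  right_nonempty := hB'
  quot_unique := hi
  cosetCount_add := hii
  bottom := hbot

end Lift

namespace Grynkiewicz2009

/-- **Lifting (17)** through coarse data relative to `H`: if `A = A₁ ∪ A'`, `B = B₁ ∪ B'` are
quasi-periodic decompositions with quasi-period `H` satisfying (i) (membership form) with
`|A + B| = |A| + |B|` and `|A' + B'| = |A'| + |B'|` (Lemma 5.3 (iii)), and if
`|(A' ∪ {α}) + (B' ∪ {β})| = |A' ∪ {α}| + |B' ∪ {β}| − 1` for holes `α ∉ A'`, `β ∉ B'` lying in the
cosets `A' + H`, `B' + H`, then `|(A ∪ {α}) + (B ∪ {β})| = |A ∪ {α}| + |B ∪ {β}| − 1`.  Indeed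
`(A ∪ {α}) + (B ∪ {β}) = P ⊔ ((A' ∪ {α}) + (B' ∪ {β}))` with `P = (A₁ + B) ∪ (A' + B₁)` `H`-periodic and
`|P| = |A₁| + |B₁|`. [cite: Grynkiewicz2009, §6 Claim 4 («it is readily checked …»)] -/
theorem seventeen_of_coarse {H : AddSubgroup G} {A B A₁ A' B₁ B' : Finset G} {α β a' b' : G}
    (hdA : IsQuasiPeriodicDecomp H A A₁ A') (hdB : IsQuasiPeriodicDecomp H B B₁ B')
    (hi : ∀ a ∈ A, ∀ b ∈ B, ∀ x ∈ A', ∀ y ∈ B', (a + b) - (x + y) ∈ H → a - x ∈ H ∧ b - y ∈ H)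
    (hAB : #(A + B) = #A + #B) (hA'B' : #(A' + B') = #A' + #B')
    (ha' : a' ∈ A') (hb' : b' ∈ B') (hα : α - a' ∈ H) (hβ : β - b' ∈ H) (hαA : α ∉ A') (hβB : β ∉ B')
    (h17 : #(insert α A' + insert β B') + 1 = #(insert α A') + #(insert β B')) :
    #(insert α A + insert β B) + 1 = #(insert α A) + #(insert β B) := by
  set P := A₁ + B ∪ (A' + B₁) with hPdef
  have hsplit : A + B = P ∪ (A' + B') := add_eq_of_coarse hdA hdB
  have hdisj : Disjoint P (A' + B') :=
    disjoint_left.2 fun p hp hc => sub_notMem_of_coarse hdA hdB hi hp hc (by rw [sub_self]; exact H.zero_mem)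
  -- the holes are outside `A`, `B`
  have hαA₁ : α ∉ A₁ := fun h => hdA.sub_notMem h ha' hα
  have hβB₁ : β ∉ B₁ := fun h => hdB.sub_notMem h hb' hβ
  have hαnot : α ∉ A := fun h => by
    rw [← hdA.union_eq, mem_union] at h
    exact h.elim hαA₁ hαA
  have hβnot : β ∉ B := fun h => by
    rw [← hdB.union_eq, mem_union] at h
    exact h.elim hβB₁ hβB
  -- `α + B₁ ⊆ P` and `A₁ + β ⊆ P`
  have hαB₁ : ∀ y ∈ B₁, α + y ∈ P := fun y hy => by
    have e : α + y = (α - a') +ᵥ (a' + y) := by rw [vadd_eq_add]; abel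
    rw [e]
    exact ((hdA.periodic.add_right B).union (hdB.periodic.add_left A')).add_mem hα
      (mem_union_right _ (add_mem_add ha' hy))
  have hA₁β : ∀ x ∈ A₁, x + β ∈ P := fun x hx => by
    have e : x + β = (β - b') +ᵥ (x + b') := by rw [vadd_eq_add]; abel
    rw [e]
    exact ((hdA.periodic.add_right B).union (hdB.periodic.add_left A')).add_mem hβ
      (mem_union_left _ (add_mem_add hx (hdB.right_subset hb')))
  -- the sum with the holes splits as `P ⊔ ((A' ∪ {α}) + (B' ∪ {β}))`
  have hsum : insert α A + insert β B = P ∪ (insert α A' + insert β B') := by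
    apply Subset.antisymm
    · intro z hz
      obtain ⟨x, hx, y, hy, rfl⟩ := mem_add.1 hz
      rw [mem_insert] at hx hy
      rw [mem_union]
      rcases hx with rfl | hx
      · rcases hy with rfl | hy
        · exact Or.inr (add_mem_add (mem_insert_self _ _) (mem_insert_self _ _))
        · rw [← hdB.union_eq, mem_union] at hy
          rcases hy with hy | hy
          · exact Or.inl (hαB₁ y hy)
          · exact Or.inr (add_mem_add (mem_insert_self _ _) (mem_insert_of_mem hy))
      · rcases hy with rfl | hy
        · rw [← hdA.union_eq, mem_union] at hx
          rcases hx with hx | hx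
          · exact Or.inl (hA₁β x hx)
          · exact Or.inr (add_mem_add (mem_insert_of_mem hx) (mem_insert_self _ _))
        · have : x + y ∈ A + B := add_mem_add hx hy
          rw [hsplit, mem_union] at this
          rcases this with h | h
          · exact Or.inl h
          · exact Or.inr (add_subset_add (subset_insert _ _) (subset_insert _ _) h)
    · apply union_subset
      · intro z hz
        have : z ∈ A + B := by rw [hsplit]; exact mem_union_left _ hz
        exact add_subset_add (subset_insert _ _) (subset_insert _ _) this
      · exact add_subset_add (insert_subset_insert _ hdA.right_subset)
          (insert_subset_insert _ hdB.right_subset)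
  -- and the two parts are disjoint (the new part stays in the coset of `A' + B'`)
  have hdisj' : Disjoint P (insert α A' + insert β B') := by
    rw [disjoint_left]
    intro p hp hc
    obtain ⟨x, hx, y, hy, rfl⟩ := mem_add.1 hc
    have hxH : x - a' ∈ H := by
      rw [mem_insert] at hx
      rcases hx with rfl | hx
      · exact hα
      · exact hdA.sub_mem x hx a' ha'
    have hyH : y - b' ∈ H := by
      rw [mem_insert] at hy
      rcases hy with rfl | hy
      · exact hβ
      · exact hdB.sub_mem y hy b' hb'
    refine sub_notMem_of_coarse hdA hdB hi hp (add_mem_add ha' hb') ?_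
    rw [add_sub_add_comm]
    exact H.add_mem hxH hyH
  have hcP : #P + (#A' + #B') = #A + #B := by
    rw [← hAB, hsplit, card_union_of_disjoint hdisj, hA'B']
  rw [hsum, card_union_of_disjoint hdisj', card_insert_of_notMem hαnot, card_insert_of_notMem hβnot]
  rw [card_insert_of_notMem hαA, card_insert_of_notMem hβB] at h17
  have := hdA.card_eq
  have := hdB.card_eq
  omega

end Grynkiewicz2009

end Literature.Combinatorics.Additive
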